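import Summits.CriticalPhenomena.PercolationContinuityZ3.Theorems.PercNearOneGluingNoHeavyPcintNawRandDefs
import HarnessLib

/-!
# PCINT lane, reduction B2r: the forcing lemmas (what the least open geodesic forces closed)

Cell `prim-pcint`, seat `prim-pcint-2`; memo `run/shared/lean/prim/pcint/REDUCTIONS.md` §B2+.1, §B2r.1.
Does NOT build on p205010.

For a site configuration `ω` on `ℤ^d` write `H_ω` for the subgraph of `𝕃^d` induced by the open sites
and `geoWords ω n` for the words of length `n` from the origin all of whose sites are open and whose
endpoint is at `H_ω`-distance exactly `n`.  We prove:
* `geoWords_nonempty_of_sitePercolatesAt` — if the open cluster of `0` is infinite, `geoWords ω n ≠ ∅`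
  (first `n` steps of a shortest open path to a far site);
* `isSAW_of_mem_geoWords`, `chordEdges_eq_empty_of_mem_geoWords` — open geodesic words are
  neighbour-avoiding walks;
* `not_mem_of_gap` — (gap) an off-path site adjacent to `v_i` and `v_j`, `i + 3 ≤ j`, is closed;
* `flipAt_mem_geoWords` / `code_flipAt_lt` / `cornerSite_not_mem_of_minimal` — (corner) if the corner
  site of a bad corner were open, exchanging the two steps would give an open geodesic word with a
  lexicographically smaller code; hence for the code-least open geodesic word it is closed;
* `forcedSites_not_mem`, `sitePercolatesAt_subset_biUnion_nawRandEvent` — the least open geodesic word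
  `γ` realises the cylinder event `nawRandEvent o γ`, so `{0 ↔ ∞} ⊆ ⋃_{γ NAW} nawRandEvent o γ` for
  every family of sibling orders `o`.
-/

noncomputable section

namespace Summit.CriticalPhenomena.PercolationContinuityZ3.Theorems.Pcint

open Finset Literature.Probability.Percolation Literature.Probability.LatticeModels

variable {d n : ℕ}

/-! ### Walks along an open word -/

/-- Consecutive sites of a word are lattice neighbours. [folklore] -/
theorem zdGraph_adj_wordPos_succ (γ : Fin n → Fin d × Bool) {k : ℕ} (hk : k < n) :
    (zdGraph d).Adj (wordPos γ k) (wordPos γ (k + 1)) :=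
  (zdGraph_adj_iff_stepVec _ _).2 ⟨γ ⟨k, hk⟩, wordPos_succ γ hk⟩

/-- An open word carries an open walk of length `j - i` from `v_i` to `v_j`. [folklore] -/
theorem exists_openWalk_wordPos {ω : SiteConfig (Site d)} {γ : Fin n → Fin d × Bool}
    (hopen : ∀ i ≤ n, wordPos γ i ∈ ω) {i j : ℕ} (hij : i ≤ j) (hj : j ≤ n) :
    ∃ W : (siteOpenGraph (zdGraph d) ω).Walk (wordPos γ i) (wordPos γ j), W.length = j - i := by
  induction j, hij using Nat.le_induction with
  | base => exact ⟨SimpleGraph.Walk.nil, by simp⟩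
  | succ j hij ih =>
    obtain ⟨W, hW⟩ := ih (by omega)
    have hadj : (siteOpenGraph (zdGraph d) ω).Adj (wordPos γ j) (wordPos γ (j + 1)) :=
      (siteOpenGraph_adj _ _ _ _).2 ⟨zdGraph_adj_wordPos_succ γ (by omega), hopen j (by omega),
        hopen (j + 1) hj⟩
    exact ⟨W.concat hadj, by rw [SimpleGraph.Walk.length_concat, hW]; omega⟩

/-! ### Open geodesic words -/

/-- **No shortcut.** An open geodesic word admits no open walk from `v_i` to `v_j` of length
`< j - i`. [folklore] -/
theorem no_shortcut_of_mem_geoWords {ω : SiteConfig (Site d)} {γ : Fin n → Fin d × Bool}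
    (hγ : γ ∈ geoWords ω n) {i j : ℕ} (hi : i ≤ n) (hj : j ≤ n)
    (P : (siteOpenGraph (zdGraph d) ω).Walk (wordPos γ i) (wordPos γ j)) (hP : i + P.length < j) :
    False := by
  obtain ⟨hopen, hdist⟩ := mem_geoWords.1 hγ
  obtain ⟨W₁, h₁⟩ := exists_openWalk_wordPos hopen (Nat.zero_le i) hi
  obtain ⟨W₂, h₂⟩ := exists_openWalk_wordPos hopen hj le_rfl
  have hle : (siteOpenGraph (zdGraph d) ω).dist (wordPos γ 0) (wordPos γ n) ≤
      (i - 0) + P.length + (n - j) := by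
    have := SimpleGraph.dist_le ((W₁.append P).append W₂)
    rwa [SimpleGraph.Walk.length_append, SimpleGraph.Walk.length_append, h₁, h₂] at this
  rw [wordPos_zero, hdist] at hle
  omega

/-- An open geodesic word is self-avoiding. [folklore] -/
theorem isSAW_of_mem_geoWords {ω : SiteConfig (Site d)} {γ : Fin n → Fin d × Bool}
    (hγ : γ ∈ geoWords ω n) : IsSAW γ := by
  intro i j hi hj hij
  by_contra hne
  rcases Nat.lt_or_gt_of_ne hne with h | h
  · exact no_shortcut_of_mem_geoWords hγ hi hj (SimpleGraph.Walk.nil.copy rfl hij) (by simp [h])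
  · exact no_shortcut_of_mem_geoWords hγ hj hi (SimpleGraph.Walk.nil.copy rfl hij.symm) (by simp [h])

/-- An open geodesic word has no chord (it is a neighbour-avoiding walk). [folklore] -/
theorem chordEdges_eq_empty_of_mem_geoWords {ω : SiteConfig (Site d)} {γ : Fin n → Fin d × Bool}
    (hγ : γ ∈ geoWords ω n) : chordEdges γ = ∅ := by
  rw [Finset.eq_empty_iff_forall_notMem]
  intro e he
  obtain ⟨i, j, hij, hjn, hadj, rfl⟩ := mem_chordEdges.1 he
  have hopen := (mem_geoWords.1 hγ).1
  have hop : (siteOpenGraph (zdGraph d) ω).Adj (wordPos γ i) (wordPos γ j) :=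
    (siteOpenGraph_adj _ _ _ _).2 ⟨hadj, hopen i (by omega), hopen j hjn⟩
  exact no_shortcut_of_mem_geoWords hγ (by omega) hjn (SimpleGraph.Walk.cons hop SimpleGraph.Walk.nil)
    (by simp; omega)

/-- Open geodesic words are neighbour-avoiding self-avoiding words. [folklore] -/
theorem mem_nawWords_of_mem_geoWords {ω : SiteConfig (Site d)} {γ : Fin n → Fin d × Bool}
    (hγ : γ ∈ geoWords ω n) : γ ∈ (sawWords d n).filter fun w => chordEdges w = ∅ :=
  mem_filter.2 ⟨mem_sawWords.2 (isSAW_of_mem_geoWords hγ), chordEdges_eq_empty_of_mem_geoWords hγ⟩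

/-- **(gap)** For an open geodesic word, a site adjacent to `v_i` and to `v_j` with `i + 3 ≤ j` is
closed (it would shortcut the geodesic by at least one step). [folklore] -/
theorem not_mem_of_gap {ω : SiteConfig (Site d)} {γ : Fin n → Fin d × Bool} (hγ : γ ∈ geoWords ω n)
    {w : Site d} {i j : ℕ} (hij : i + 3 ≤ j) (hj : j ≤ n) (hi : (zdGraph d).Adj (wordPos γ i) w)
    (hjw : (zdGraph d).Adj (wordPos γ j) w) : w ∉ ω := by
  intro hw
  have hopen := (mem_geoWords.1 hγ).1
  have h1 : (siteOpenGraph (zdGraph d) ω).Adj (wordPos γ i) w :=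
    (siteOpenGraph_adj _ _ _ _).2 ⟨hi, hopen i (by omega), hw⟩
  have h2 : (siteOpenGraph (zdGraph d) ω).Adj w (wordPos γ j) :=
    (siteOpenGraph_adj _ _ _ _).2 ⟨hjw.symm, hw, hopen j hj⟩
  exact no_shortcut_of_mem_geoWords hγ (by omega) hj
    (SimpleGraph.Walk.cons h1 (SimpleGraph.Walk.cons h2 SimpleGraph.Walk.nil)) (by simp; omega)

/-- Gap-set sites are closed. [folklore] -/
theorem not_mem_of_mem_gapSet {ω : SiteConfig (Site d)} {γ : Fin n → Fin d × Bool}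
    (hγ : γ ∈ geoWords ω n) {t : ℕ} (ht : t ≤ n) {w : Site d} (hw : w ∈ gapSet γ t) : w ∉ ω := by
  obtain ⟨hadj, -, i, hi, hiw⟩ := mem_gapSet.1 hw
  exact not_mem_of_gap hγ hi ht hiw hadj

/-! ### Existence of open geodesic words -/

/-- **Long open geodesics exist.** If the open site cluster of `0` is infinite then for every `n`
there is an open geodesic word of length `n` (REDUCTIONS.md §R1: a shortest open path to a site of
the cluster not reachable in fewer than `n` steps, first `n` steps; prefixes of geodesics are
geodesics). [folklore] -/
theorem geoWords_nonempty_of_sitePercolatesAt {ω : SiteConfig (Site d)}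
    (hC : ω ∈ sitePercolatesAt (zdGraph d) (0 : Site d)) (n : ℕ) : (geoWords ω n).Nonempty := by
  classical
  set H := siteOpenGraph (zdGraph d) ω with hH
  have hG : H ≤ zdGraph d := fun a b hab => ((siteOpenGraph_adj _ _ _ _).1 hab).1
  have hC' : (siteCluster (zdGraph d) ω 0).Infinite := hC
  set S : Set (Site d) := ⋃ k : Fin n, Set.range fun w : Fin k → Fin d × Bool => wordPos w k
  have hS : S.Finite := Set.finite_iUnion fun _ => Set.finite_range _
  obtain ⟨y, hyC, hyS⟩ := (hC'.sdiff hS).nonempty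
  obtain ⟨h0, -, hreach⟩ := hyC
  obtain ⟨r, -, hrl⟩ := hreach.exists_path_of_dist
  have hn : n ≤ r.length := by
    by_contra hlt
    push Not at hlt
    obtain ⟨w, hw⟩ := exists_word_of_walk hG r r.length le_rfl
    exact hyS (Set.mem_iUnion.2 ⟨⟨r.length, hlt⟩, w, by simpa using hw r.length le_rfl⟩)
  obtain ⟨w, hw⟩ := exists_word_of_walk hG r n hn
  have hopen : ∀ i ≤ r.length, r.getVert i ∈ ω := by
    intro i hi
    rcases Nat.eq_zero_or_pos i with rfl | hpos
    · rw [SimpleGraph.Walk.getVert_zero]; exact h0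
    · obtain ⟨k, rfl⟩ : ∃ k, i = k + 1 := ⟨i - 1, by omega⟩
      exact ((siteOpenGraph_adj _ _ _ _).1 (r.adj_getVert_succ (by omega : k < r.length))).2.2
  refine ⟨w, mem_geoWords.2 ⟨fun i hi => by rw [hw i hi]; exact hopen i (hi.trans hn), ?_⟩⟩
  rw [hw n le_rfl]
  apply le_antisymm
  · have := SimpleGraph.dist_le (r.take n)
    rw [SimpleGraph.Walk.take_length, Nat.min_eq_left hn] at this
    exact this
  · by_contra hlt
    push Not at hlt
    obtain ⟨Q, hQ⟩ := (r.take n).reachable.exists_walk_length_eq_dist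
    have hle := SimpleGraph.dist_le (Q.append (r.drop n))
    rw [SimpleGraph.Walk.length_append, hQ, SimpleGraph.Walk.drop_length, ← hrl] at hle
    omega

/-- For every family of sibling orders there is a code-least open geodesic word. [folklore] -/
theorem exists_minimal_geoWord {ω : SiteConfig (Site d)}
    (hC : ω ∈ sitePercolatesAt (zdGraph d) (0 : Site d)) (o : Orders d n) :
    ∃ γ ∈ geoWords ω n, ∀ γ' ∈ geoWords ω n, code o γ ≤ code o γ' :=
  exists_min_image _ (code o) (geoWords_nonempty_of_sitePercolatesAt hC n)

/-! ### The flipped word -/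

/-- Words agreeing on their first `k` steps visit the same `k`-th site. [folklore] -/
theorem wordPos_congr {γ γ' : Fin n → Fin d × Bool} {k : ℕ}
    (h : ∀ (i : ℕ) (hi : i < n), i < k → γ ⟨i, hi⟩ = γ' ⟨i, hi⟩) : wordPos γ k = wordPos γ' k := by
  unfold wordPos
  refine sum_congr rfl fun i hi => ?_
  rw [mem_range] at hi
  split_ifs with hin
  · rw [h i hin hi]
  · rfl

/-- Steps of the flipped word away from the two exchanged positions. [folklore] -/
theorem flipAt_apply_of_ne (γ : Fin n → Fin d × Bool) {s : ℕ} (h : s + 2 ≤ n) (i : Fin n)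
    (h1 : (i : ℕ) ≠ s) (h2 : (i : ℕ) ≠ s + 1) : flipAt γ s h i = γ i := by
  simp only [flipAt, Function.comp_apply]
  rw [Equiv.swap_apply_of_ne_of_ne] <;> exact fun hh => by simp [Fin.ext_iff] at hh; omega

/-- The flipped word at position `s` is the old step `s + 1`. [folklore] -/
theorem flipAt_apply_left (γ : Fin n → Fin d × Bool) {s : ℕ} (h : s + 2 ≤ n) :
    flipAt γ s h ⟨s, by omega⟩ = γ ⟨s + 1, by omega⟩ := by
  simp only [flipAt, Function.comp_apply, Equiv.swap_apply_left]

/-- The flipped word at position `s + 1` is the old step `s`. [folklore] -/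
theorem flipAt_apply_right (γ : Fin n → Fin d × Bool) {s : ℕ} (h : s + 2 ≤ n) :
    flipAt γ s h ⟨s + 1, by omega⟩ = γ ⟨s, by omega⟩ := by
  simp only [flipAt, Function.comp_apply, Equiv.swap_apply_right]

/-- The flipped word visits the same sites before the flip. [folklore] -/
theorem wordPos_flipAt_of_le (γ : Fin n → Fin d × Bool) {s : ℕ} (h : s + 2 ≤ n) {k : ℕ} (hk : k ≤ s) :
    wordPos (flipAt γ s h) k = wordPos γ k :=
  wordPos_congr fun i hi hik => flipAt_apply_of_ne γ h ⟨i, hi⟩ (by simp; omega) (by simp; omega)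

/-- At the flip, the flipped word visits the corner site. [folklore] -/
theorem wordPos_flipAt_succ (γ : Fin n → Fin d × Bool) {s : ℕ} (h : s + 2 ≤ n) :
    wordPos (flipAt γ s h) (s + 1) = cornerSite γ s := by
  rw [wordPos_succ _ (by omega), wordPos_flipAt_of_le γ h le_rfl, flipAt_apply_left, cornerSite,
    dif_pos (by omega)]

/-- After the flip, the flipped word visits the same sites again. [folklore] -/
theorem wordPos_flipAt_of_ge (γ : Fin n → Fin d × Bool) {s : ℕ} (h : s + 2 ≤ n) {k : ℕ}
    (hk : s + 2 ≤ k) : wordPos (flipAt γ s h) k = wordPos γ k := by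
  induction k, hk using Nat.le_induction with
  | base =>
    rw [wordPos_succ _ (by omega), wordPos_succ _ (by omega), wordPos_flipAt_of_le γ h le_rfl,
      flipAt_apply_left, flipAt_apply_right, wordPos_succ γ (by omega : s + 1 < n),
      wordPos_succ γ (by omega : s < n), add_assoc, add_assoc, add_comm (stepVec (γ ⟨s + 1, _⟩))]
  | succ k hk ih =>
    by_cases hkn : k < n
    · rw [wordPos_succ _ hkn, wordPos_succ _ hkn, ih,
        flipAt_apply_of_ne γ h ⟨k, hkn⟩ (by simp; omega) (by simp; omega)]
    · unfold wordPos at ih ⊢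
      rw [sum_range_succ, sum_range_succ, dif_neg hkn, dif_neg hkn]
      exact congrArg (· + 0) ih

/-- Sites of the flipped word away from position `s + 1`. [folklore] -/
theorem wordPos_flipAt_of_ne (γ : Fin n → Fin d × Bool) {s : ℕ} (h : s + 2 ≤ n) {k : ℕ}
    (hk : k ≠ s + 1) : wordPos (flipAt γ s h) k = wordPos γ k := by
  rcases le_or_gt k s with hks | hks
  · exact wordPos_flipAt_of_le γ h hks
  · exact wordPos_flipAt_of_ge γ h (by omega)

/-- **(corner, i)** If the corner site is open, the flipped word is again an open geodesic word.
[folklore] -/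
theorem flipAt_mem_geoWords {ω : SiteConfig (Site d)} {γ : Fin n → Fin d × Bool}
    (hγ : γ ∈ geoWords ω n) {s : ℕ} (h : s + 2 ≤ n) (hw : cornerSite γ s ∈ ω) :
    flipAt γ s h ∈ geoWords ω n := by
  obtain ⟨hopen, hdist⟩ := mem_geoWords.1 hγ
  refine mem_geoWords.2 ⟨fun i hi => ?_, ?_⟩
  · by_cases his : i = s + 1
    · subst his; rw [wordPos_flipAt_succ]; exact hw
    · rw [wordPos_flipAt_of_ne γ h his]; exact hopen i hi
  · rw [wordPos_flipAt_of_ne γ h (by omega)]; exact hdist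

/-- The prefix node of length `t ≤ s` is unchanged by the flip. [folklore] -/
theorem pnode_flipAt (γ : Fin n → Fin d × Bool) {s : ℕ} (h : s + 2 ≤ n) (t : Fin n) (ht : (t : ℕ) ≤ s) :
    pnode (flipAt γ s h) t = pnode γ t := by
  unfold pnode
  congr 1
  funext i
  exact flipAt_apply_of_ne γ h _ (by simp; omega) (by simp; omega)

/-- **(corner, ii)** A bad corner's flip has a strictly smaller code. [folklore] -/
theorem code_flipAt_lt {o : Orders d n} {γ : Fin n → Fin d × Bool} {s : ℕ} (h : s + 2 ≤ n)
    (hbad : IsBad o γ s) : code o (flipAt γ s h) < code o γ := by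
  obtain ⟨h', hlt⟩ := hbad
  show Pi.Lex (· < ·) (· < ·) (digit o (flipAt γ s h)) (digit o γ)
  refine ⟨⟨s, by omega⟩, fun j hj => ?_, ?_⟩
  · have hj' : (j : ℕ) < s := hj
    simp only [digit]
    rw [pnode_flipAt γ h j hj'.le, flipAt_apply_of_ne γ h j (by omega) (by omega)]
  · simp only [digit]
    rw [pnode_flipAt γ h _ le_rfl, flipAt_apply_left]
    exact hlt

/-- **(corner, iii)** For the code-least open geodesic word, the corner site of every bad corner is
closed. [folklore] -/
theorem cornerSite_not_mem_of_minimal {ω : SiteConfig (Site d)} {o : Orders d n}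
    {γ : Fin n → Fin d × Bool} (hγ : γ ∈ geoWords ω n)
    (hmin : ∀ γ' ∈ geoWords ω n, code o γ ≤ code o γ') {s : ℕ} (hbad : IsBad o γ s) :
    cornerSite γ s ∉ ω := by
  intro hw
  obtain ⟨h, hlt⟩ := hbad
  exact (code_flipAt_lt h ⟨h, hlt⟩).not_ge (hmin _ (flipAt_mem_geoWords hγ h hw))

/-! ### The least open geodesic word realises the cylinder event -/

/-- All forced sites of the code-least open geodesic word are closed. [folklore] -/
theorem forcedSites_not_mem {ω : SiteConfig (Site d)} {o : Orders d n} {γ : Fin n → Fin d × Bool}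
    (hγ : γ ∈ geoWords ω n) (hmin : ∀ γ' ∈ geoWords ω n, code o γ ≤ code o γ') :
    ∀ w ∈ forcedSites o γ, w ∉ ω := by
  intro w hw
  rw [forcedSites, mem_image] at hw
  obtain ⟨⟨t, w⟩, htw, rfl⟩ := hw
  rw [chargedPairs, mem_union] at htw
  rcases htw with htw | htw
  · rw [gapPairs, mem_biUnion] at htw
    obtain ⟨t', ht', htw⟩ := htw
    rw [mem_image] at htw
    obtain ⟨w', hw', he⟩ := htw
    obtain ⟨rfl, rfl⟩ := Prod.mk.inj he
    exact not_mem_of_mem_gapSet hγ (by simpa [Nat.lt_succ_iff] using ht') hw'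
  · rw [badPairs, mem_image] at htw
    obtain ⟨s, hs, he⟩ := htw
    obtain ⟨-, rfl⟩ := Prod.mk.inj he
    exact cornerSite_not_mem_of_minimal (s := (s : ℕ)) hγ hmin (mem_badTimes.1 hs).2

/-- The code-least open geodesic word realises its cylinder event. [folklore] -/
theorem mem_nawRandEvent_of_minimal {ω : SiteConfig (Site d)} {o : Orders d n}
    {γ : Fin n → Fin d × Bool} (hγ : γ ∈ geoWords ω n)
    (hmin : ∀ γ' ∈ geoWords ω n, code o γ ≤ code o γ') : ω ∈ nawRandEvent o γ := by
  refine ⟨fun x hx => ?_, forcedSites_not_mem hγ hmin⟩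
  obtain ⟨i, hi, rfl⟩ := mem_pathSites.1 (mem_coe.1 hx)
  exact (mem_geoWords.1 hγ).1 i hi

/-- **Forcing.** For every family of sibling orders `o` and every `n`: site percolation from the
origin implies the cylinder event of some neighbour-avoiding word of length `n`. [folklore] -/
theorem sitePercolatesAt_subset_biUnion_nawRandEvent (o : Orders d n) :
    sitePercolatesAt (zdGraph d) (0 : Site d) ⊆
      ⋃ γ ∈ (sawWords d n).filter (fun w => chordEdges w = ∅), nawRandEvent o γ := by
  intro ω hω
  obtain ⟨γ, hγ, hmin⟩ := exists_minimal_geoWord hω o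
  exact Set.mem_biUnion (mem_coe.2 (mem_nawWords_of_mem_geoWords hγ)) (mem_nawRandEvent_of_minimal hγ hmin)

end Summit.CriticalPhenomena.PercolationContinuityZ3.Theorems.Pcint
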